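import Summits.ResolutionOfSingularities.ResolutionOfSingularities.Theorems.FrobeniusLadderFRationalResolutionPrimaryDescent
import Mathlib.RingTheory.Localization.Ideal
import Mathlib.RingTheory.Localization.Away.Basic
import HarnessLib

/-!
# Crux `FrobeniusLadder.FRationalResolution` (stmt-ResolutionOfSingularities-15317), line `redirect`,
# stub `stub_diagonalizableQuotientResolution` — descent of the chart's `𝔪`-primary centre (ring form)

Brick T3-b of the repair census: the input `I` of `…ChartTransfer.coneModelData_of_flat_chart` (a `𝔭`-primary
centre downstairs whose extension to the chart is the chart's centre) is produced from the chart-side data by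
`…PrimaryDescent.map_comap_eq_of_pow_le` (p811818). Setting: `B → C` the chart ring map, `𝔭 ⊆ B` maximal,
`𝔔 ⊆ C` a maximal ideal over `𝔭` with TRIVIAL residue extension (every `c ∈ C` is `≡ f(b) mod 𝔔`), `g ∉ 𝔔` such
that over `D(g)` the fibre of `𝔭` is the reduced point `𝔔` (`𝔔 C_g ≤ 𝔭 C_g`: `𝔔` the only point over `𝔭` in `D(g)`
and `B → C` unramified at `𝔔`), and `J ⊆ C` with `𝔔ᵏ ⊆ J ⊆ 𝔔` (the chart's `𝔪_𝔔`-primary centre).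

* `residual_surjective_away` — residue surjectivity survives on `C_g` modulo `𝔔 C_g`;
* `exists_descended_centre` — **there is `I ⊆ B` with `𝔭ᵏ ⊆ I ⊆ 𝔭` and `I C_g = J C_g`** (namely
  `I = f⁻¹(J C_g)`), so that `Bl_{I C_g} = Bl_{J C_g}` is an open piece of `Bl_J`.

Honest label: plumbing (no stub closed). No definitions, no named facts, no sorry.
[folklore; cite: StacksProject, Tag 00UW]
-/

noncomputable section

-- single-problem summit: the doubled namespace component is forced
set_option linter.dupNamespace false

namespace Summit.ResolutionOfSingularities.ResolutionOfSingularities.Theorems.FRationalResolution.CentreDescent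

universe u

variable {B C : Type u} [CommRing B] [CommRing C] [Algebra B C]

/-- **Residue surjectivity passes to `C_g`**: if every element of `C` is congruent modulo the maximal ideal `𝔔`
to an element of `f(B)` and `g ∉ 𝔔`, then every element of `C_g` is congruent modulo `𝔔 C_g` to an element of
`f(B)` (`c/gᵐ ≡ c·d` with `d gᵐ ≡ 1 mod 𝔔`). [folklore] -/
theorem residual_surjective_away (𝔔 : Ideal C) [h𝔔 : 𝔔.IsMaximal]
    (hres : ∀ c : C, ∃ b : B, c - algebraMap B C b ∈ 𝔔) (g : C) (hg : g ∉ 𝔔)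
    (C' : Type u) [CommRing C'] [Algebra C C'] [IsLocalization.Away g C'] (x : C') :
    ∃ b : B, x - algebraMap C C' (algebraMap B C b) ∈ 𝔔.map (algebraMap C C') := by
  obtain ⟨⟨c, s⟩, hx⟩ := IsLocalization.surj (Submonoid.powers g) x
  -- `hx : x * algebraMap C C' s = algebraMap C C' c`, `s = g ^ m`
  obtain ⟨m, hm⟩ := (Submonoid.mem_powers_iff _ _).mp s.2
  have hs𝔔 : (s : C) ∉ 𝔔 := fun h => hg (h𝔔.isPrime.mem_of_pow_mem m (hm ▸ h))
  obtain ⟨d, i, hi, hdi⟩ := h𝔔.exists_inv hs𝔔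
  -- `x ≡ c d (mod 𝔔 C')`
  have hunit : IsUnit (algebraMap C C' s) := IsLocalization.map_units C' s
  have h1 : x - algebraMap C C' (c * d) ∈ 𝔔.map (algebraMap C C') := by
    rw [← Ideal.mul_unit_mem_iff_mem _ hunit]
    have heq : (x - algebraMap C C' (c * d)) * algebraMap C C' s = algebraMap C C' (c * i) := by
      rw [sub_mul, hx, ← map_mul]
      have : c * d * (s : C) = c - c * i := by
        have := hdi
        linear_combination c * this
      rw [this, map_sub, map_mul, sub_sub_cancel]
    rw [heq]
    exact Ideal.mem_map_of_mem _ (𝔔.mul_mem_left c hi)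
  obtain ⟨b, hb⟩ := hres (c * d)
  refine ⟨b, ?_⟩
  have h2 : algebraMap C C' (c * d) - algebraMap C C' (algebraMap B C b) ∈ 𝔔.map (algebraMap C C') := by
    rw [← map_sub]
    exact Ideal.mem_map_of_mem _ hb
  have := Ideal.add_mem _ h1 h2
  rwa [sub_add_sub_cancel] at this

/-- **Descent of the chart's centre.** Let `𝔭 ⊆ B` be maximal, `𝔔 ⊆ C` maximal with `𝔭 ⊆ f⁻¹𝔔` and trivial
residue extension, `g ∉ 𝔔` with `𝔔 C_g ≤ 𝔭 C_g` (over `D(g)` the fibre of `𝔭` is the reduced point `𝔔`: `𝔔` is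
the only point over `𝔭` there and `B → C` is unramified at `𝔔`), and `J ⊆ C` with `𝔔ᵏ ⊆ J`. Then
`I := f⁻¹(J C_g) ⊆ B` satisfies `𝔭ᵏ ⊆ I`, `I C_g = J C_g`, and `I ⊆ 𝔭` as soon as `J ⊆ 𝔔`
(`…PrimaryDescent.map_comap_eq_of_pow_le`). [cite: StacksProject, Tag 00UW] -/
theorem exists_descended_centre (𝔭 : Ideal B) [h𝔭 : 𝔭.IsMaximal] (𝔔 : Ideal C) [h𝔔 : 𝔔.IsMaximal]
    (hover : 𝔭 ≤ 𝔔.comap (algebraMap B C))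
    (hres : ∀ c : C, ∃ b : B, c - algebraMap B C b ∈ 𝔔) (g : C) (hg : g ∉ 𝔔)
    (C' : Type u) [CommRing C'] [Algebra C C'] [IsLocalization.Away g C']
    (hunr : 𝔔.map (algebraMap C C') ≤ 𝔭.map ((algebraMap C C').comp (algebraMap B C)))
    (J : Ideal C) {k : ℕ} (hJ : 𝔔 ^ k ≤ J) (hJ𝔔 : J ≤ 𝔔) :
    ∃ I : Ideal B, 𝔭 ^ k ≤ I ∧ I ≤ 𝔭 ∧
      I.map ((algebraMap C C').comp (algebraMap B C)) = J.map (algebraMap C C') := by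
  set f : B →+* C' := (algebraMap C C').comp (algebraMap B C) with hf
  have hres' : ∀ x : C', ∃ b : B, x - f b ∈ 𝔔.map (algebraMap C C') :=
    fun x => residual_surjective_away 𝔔 hres g hg C' x
  -- `𝔭ᵏ C_g ≤ J C_g`
  have hpQ : 𝔭.map f ≤ 𝔔.map (algebraMap C C') := by
    rw [hf, ← Ideal.map_map]
    exact Ideal.map_mono (Ideal.map_le_iff_le_comap.mpr hover)
  have hJ' : (𝔭 ^ k).map f ≤ J.map (algebraMap C C') := by
    rw [Ideal.map_pow]
    refine (Ideal.pow_right_mono hpQ k).trans ?_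
    rw [← Ideal.map_pow]
    exact Ideal.map_mono hJ
  obtain ⟨hmap, hpow⟩ :=
    PrimaryDescent.map_comap_eq_of_pow_le f 𝔭 (𝔔.map (algebraMap C C')) hunr hres' hJ'
  refine ⟨(J.map (algebraMap C C')).comap f, hpow, ?_, hmap⟩
  -- `I ≤ f⁻¹(𝔔 C_g) = 𝔭`
  have hdisj : Disjoint ((Submonoid.powers g : Submonoid C) : Set C) (𝔔 : Set C) := by
    refine Set.disjoint_left.mpr ?_
    rintro x ⟨m, rfl⟩ hx
    exact hg (h𝔔.isPrime.mem_of_pow_mem m hx)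
  have hQ' : (𝔔.map (algebraMap C C')).comap (algebraMap C C') = 𝔔 :=
    IsLocalization.under_map_of_isPrime_disjoint (Submonoid.powers g) C' h𝔔.isPrime hdisj
  intro x hx
  have hx' : f x ∈ 𝔔.map (algebraMap C C') := (Ideal.map_mono hJ𝔔) hx
  have hxQ : algebraMap B C x ∈ 𝔔 := by
    rw [← hQ']
    exact hx'
  -- `f⁻¹𝔔 = 𝔭` by maximality
  have hcomap : 𝔔.comap (algebraMap B C) = 𝔭 :=
    (h𝔭.eq_of_le (Ideal.IsPrime.ne_top inferInstance) hover).symm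
  rw [← hcomap]
  exact hxQ

end Summit.ResolutionOfSingularities.ResolutionOfSingularities.Theorems.FRationalResolution.CentreDescent

end
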